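import Summits.ValiantsHypothesis.ValiantsHypothesis.Theorems.ZeroOneTransfer.Negative.Exchange
import Summits.ValiantsHypothesis.ValiantsHypothesis.Theorems.ZeroOneTransfer.Negative.TopComponentFree

/-!
# `ZeroOneTransfer` — negative lemma: A FACE OF `ST_2` IS NOT A POSITIVE PROJECTION OF ANY `ST_N`

Crux `stmt-ValiantsHypothesis-5066` (`Theses.DivisionGap.ZeroOneTransfer`, route DivisionGap).
Standing disprover (cdisprove gen 2), `Cruxes/ZeroOneTransfer/Disproof.lean` §(G); uses the
exchange-connectivity obstruction of `Exchange.lean`.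

* `not_posProj_XaXb_add_XcXd` — `x_a x_b + x_c x_d` (`c, d ∉ {a, b}`, `c ≠ d`) is not a positive
  projection of any `ST_N` (its two monomials are two labels apart).
* `stPoly_two`, `topComponent_stPoly_two` — `ST_2 = x_{0r}x_{1r} + x_{01}x_{1r} + x_{0r}x_{10}`, and
  its initial form selecting the two paths is `x_{01}x_{1r} + x_{0r}x_{10}`.
* `face_of_stPoly_two_not_posProj` — so **positive `ST`-projections are NOT closed under initial
  forms**: the obstruction theory "(4) faces of arborescence polytopes are arborescence polytopes
  of sub-digraphs" of card arborescence-span is false as stated (faces are LAMINAR-TIGHT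
  arborescence families; a face-closed positive normal form on `ST` needs them, or `J ≥ 2`
  summands already for a 2-term face).
[folklore] [cite: JerrumSnir1982, §4.5]
-/

namespace Summit.ValiantsHypothesis.ValiantsHypothesis.Theorems.ZeroOneTransfer.Negative

set_option linter.dupNamespace false

open Literature.Computability.AlgebraicComplexity Literature.Barriers.ValiantsHypothesis
open MvPolynomial Finset
open scoped NNReal

noncomputable section

section Face

variable {τ : Type*}

/-- The arithmetic core: `e_c + e_d + p₁ = e_a + e_b + p₂` is impossible for `c, d ∉ {a, b}`,
`c ≠ d` and `p₂ ∈ {0} ∪ {e_j}`. [folklore] -/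
theorem single_add_single_ne {a b c d : τ} (hca : c ≠ a) (hcb : c ≠ b) (hda : d ≠ a)
    (hdb : d ≠ b) (hcd : c ≠ d) {p₁ p₂ : τ →₀ ℕ} (hp₂ : p₂ = 0 ∨ ∃ j, p₂ = Finsupp.single j 1)
    (h : Finsupp.single c 1 + Finsupp.single d 1 + p₁ = Finsupp.single a 1 + Finsupp.single b 1 + p₂) :
    False := by
  classical
  have hc := congrArg (fun f => f c) h
  have hd := congrArg (fun f => f d) h
  simp only [Finsupp.add_apply, Finsupp.single_eq_same, Finsupp.single_eq_of_ne hcd.symm,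
    Finsupp.single_eq_of_ne hcd, Finsupp.single_eq_of_ne hca, Finsupp.single_eq_of_ne hcb,
    Finsupp.single_eq_of_ne hda, Finsupp.single_eq_of_ne hdb] at hc hd
  rcases hp₂ with rfl | ⟨j, rfl⟩
  · simp at hc
  · by_cases hjc : j = c
    · rw [hjc, Finsupp.single_eq_of_ne hcd.symm] at hd
      omega
    · rw [Finsupp.single_eq_of_ne (Ne.symm hjc)] at hc
      omega

/-- **`x_a x_b + x_c x_d` is not a positive projection of any `ST_N`** (`c, d ∉ {a, b}`, `c ≠ d`):
its two monomials `e_a + e_b`, `e_c + e_d` are not one label apart, so the support is isolated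
(`not_posProj_stPoly_of_isolated`). [folklore] -/
theorem not_posProj_XaXb_add_XcXd {a b c d : τ} (hca : c ≠ a) (hcb : c ≠ b) (hda : d ≠ a)
    (hdb : d ≠ b) (hcd : c ≠ d) :
    ¬ ∃ (N : ℕ) (e : Fin N × Option (Fin N) → MvPolynomial τ ℝ≥0),
      (∀ v, (∃ j, e v = X j) ∨ ∃ r, e v = C r) ∧
      aeval e (stPoly ℝ≥0 N) = X a * X b + X c * X d := by
  classical
  set mab : τ →₀ ℕ := Finsupp.single a 1 + Finsupp.single b 1 with hmab
  set mcd : τ →₀ ℕ := Finsupp.single c 1 + Finsupp.single d 1 with hmcd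
  have hP : (X a * X b + X c * X d : MvPolynomial τ ℝ≥0) = monomial mab 1 + monomial mcd 1 := by
    simp only [hmab, hmcd, X, monomial_mul, mul_one]
  have hne : mab ≠ mcd := by
    intro h
    have := congrArg (fun f => f c) h
    simp only [hmab, hmcd, Finsupp.add_apply, Finsupp.single_eq_same,
      Finsupp.single_eq_of_ne hca, Finsupp.single_eq_of_ne hcb,
      Finsupp.single_eq_of_ne hcd] at this
    omega
  have hcoeff : ∀ γ, coeff γ (X a * X b + X c * X d : MvPolynomial τ ℝ≥0) =
      (if mab = γ then 1 else 0) + (if mcd = γ then 1 else 0) := by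
    intro γ; rw [hP, coeff_add, coeff_monomial, coeff_monomial]
  have hsupp : ∀ γ, coeff γ (X a * X b + X c * X d : MvPolynomial τ ℝ≥0) ≠ 0 →
      γ = mab ∨ γ = mcd := by
    intro γ hγ
    rw [hcoeff] at hγ
    by_contra hno
    push Not at hno
    rw [if_neg (Ne.symm hno.1), if_neg (Ne.symm hno.2), add_zero] at hγ
    exact hγ rfl
  refine not_posProj_stPoly_of_isolated ⟨mab, mcd, hne, ?_, ?_⟩ ?_
  · rw [hcoeff, if_pos rfl]; exact ne_of_gt (add_pos_of_pos_of_nonneg one_pos zero_le)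
  · rw [hcoeff, if_pos rfl]; exact ne_of_gt (add_pos_of_nonneg_of_pos zero_le one_pos)
  · intro α β hα hβ p q hq h
    rcases hsupp α hα with rfl | rfl <;> rcases hsupp β hβ with rfl | rfl
    · rfl
    · exact (single_add_single_ne hca hcb hda hdb hcd hq h).elim
    · -- `mab + p = mcd + q`: the symmetric instance (`a, b ∉ {c, d}`; if `a = b` evaluate twice)
      exfalso
      have hc' := congrArg (fun f => f a) h
      have hd' := congrArg (fun f => f b) h
      simp only [hmab, hmcd, Finsupp.add_apply, Finsupp.single_eq_same,
        Finsupp.single_eq_of_ne (Ne.symm hca), Finsupp.single_eq_of_ne (Ne.symm hda),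
        Finsupp.single_eq_of_ne (Ne.symm hcb), Finsupp.single_eq_of_ne (Ne.symm hdb)] at hc' hd'
      rcases hq with rfl | ⟨j, rfl⟩
      · simp only [Finsupp.coe_zero, Pi.zero_apply, add_zero] at hc'
        rw [Finsupp.single_apply] at hc'
        split_ifs at hc' <;> omega
      · rw [Finsupp.single_apply, Finsupp.single_apply] at hc'
        rw [Finsupp.single_apply, Finsupp.single_apply] at hd'
        by_cases hja : j = a
        · subst hja
          simp only [if_true] at hc' hd'
          split_ifs at hc' hd' <;> omega
        · rw [if_neg hja] at hc'
          split_ifs at hc' <;> omega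
    · rfl

end Face

/-! ### A two-term face of `ST_2` -/

section Two

/-- The arborescences on two non-root nodes: the star and the two paths. [folklore] -/
theorem isArborescence_two_iff (t : Fin 2 → Option (Fin 2)) :
    IsArborescence t ↔ (t 0 = none ∧ t 1 = none) ∨ (t 0 = some 1 ∧ t 1 = none) ∨
      (t 0 = none ∧ t 1 = some 0) := by
  rw [isArborescence_iff_exists_rank]
  constructor
  · rintro ⟨rk, hrk⟩
    have h00 : t 0 ≠ some 0 := fun h => lt_irrefl _ (hrk 0 0 h)
    have h11 : t 1 ≠ some 1 := fun h => lt_irrefl _ (hrk 1 1 h)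
    have hcyc : ¬ (t 0 = some 1 ∧ t 1 = some 0) := fun ⟨h1, h2⟩ => by
      have := hrk 0 1 h1; have := hrk 1 0 h2; omega
    rcases h0 : t 0 with _ | j0 <;> rcases h1 : t 1 with _ | j1
    · exact Or.inl ⟨rfl, rfl⟩
    · right; right
      refine ⟨rfl, ?_⟩
      fin_cases j1
      · rfl
      · exact absurd h1 h11
    · right; left
      refine ⟨?_, rfl⟩
      fin_cases j0
      · exact absurd h0 h00
      · rfl
    · exfalso
      fin_cases j0
      · exact h00 h0
      · fin_cases j1
        · exact hcyc ⟨h0, h1⟩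
        · exact h11 h1
  · rintro (⟨h0, h1⟩ | ⟨h0, h1⟩ | ⟨h0, h1⟩)
    · refine ⟨fun _ => 0, fun i j hij => ?_⟩
      fin_cases i
      · simp [h0] at hij
      · simp [h1] at hij
    · refine ⟨fun i => if i = 0 then 1 else 0, fun i j hij => ?_⟩
      fin_cases i
      · simp only [h0, Fin.zero_eta, Option.some.injEq] at hij; subst hij; simp
      · simp [h1] at hij
    · refine ⟨fun i => if i = 1 then 1 else 0, fun i j hij => ?_⟩
      fin_cases i
      · simp [h0] at hij
      · simp only [h1, Fin.mk_one, Option.some.injEq] at hij; subst hij; simp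

/-- The three arborescences on two non-root nodes, as parent maps. [folklore] -/
theorem arborescences_two : arborescences 2 =
    {(![none, none] : Fin 2 → Option (Fin 2)), ![some 1, none], ![none, some 0]} := by
  ext t
  rw [mem_arborescences, isArborescence_two_iff]
  simp only [Finset.mem_insert, Finset.mem_singleton]
  have ht : ∀ (x y : Option (Fin 2)), (t 0 = x ∧ t 1 = y) ↔ t = ![x, y] := by
    intro x y
    constructor
    · rintro ⟨h0, h1⟩; funext i; fin_cases i <;> simp [h0, h1]
    · rintro rfl; simp
  rw [ht, ht, ht]

/-- **`ST_2` explicitly**: `x_{0r} x_{1r} + x_{01} x_{1r} + x_{0r} x_{10}`. [folklore] -/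
theorem stPoly_two (R : Type*) [CommSemiring R] :
    stPoly R 2 = X (0, none) * X (1, none) + X (0, some 1) * X (1, none) +
      X (0, none) * X (1, some 0) := by
  classical
  rw [stPoly_eq_sum_monomial, arborescences_two, Finset.sum_insert, Finset.sum_insert,
    Finset.sum_singleton]
  · simp only [← prod_X_arb_eq_monomial, Fin.prod_univ_two, Matrix.cons_val_zero,
      Matrix.cons_val_one]
    ring
  · simp only [Finset.mem_singleton]
    intro h
    have := congrFun h 0
    simp at this
  · simp only [Finset.mem_insert, Finset.mem_singleton, not_or]
    constructor
    · intro h; have := congrFun h 0; simp at this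
    · intro h; have := congrFun h 1; simp at this

/-- The weight selecting the two path trees: `1` on `x_{01}` and `x_{10}`, `0` elsewhere.
[folklore] -/
def faceWeight : Fin 2 × Option (Fin 2) → ℕ := fun v =>
  if v = (0, some 1) ∨ v = (1, some 0) then 1 else 0

/-- Top component of `q + r` when `r ≠ 0` is weighted homogeneous of degree above that of `q`.
[folklore] -/
theorem topComponent_add_eq_right {σ : Type*} (w : σ → ℕ) {q r : MvPolynomial σ ℝ≥0} {n : ℕ}
    (hr : IsWeightedHomogeneous w r n) (hr0 : r ≠ 0)
    (hq : ∀ d ∈ q.support, Finsupp.weight w d < n) : topComponent w (q + r) = r := by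
  classical
  -- the weighted degree of `q + r` is `n`
  have hdeg : weightedTotalDegree w (q + r) = n := by
    apply le_antisymm
    · refine Finset.sup_le fun d hd => ?_
      rcases Finset.mem_union.1 (support_add hd) with h | h
      · exact (hq d h).le
      · exact (hr (mem_support_iff.mp h)).le
    · obtain ⟨d, hd⟩ := exists_coeff_ne_zero hr0
      have hdn : Finsupp.weight w d = n := hr hd
      have hdq : coeff d q = 0 := by
        by_contra h
        exact absurd hdn (ne_of_lt (hq d (mem_support_iff.mpr h)))
      have hmem : d ∈ (q + r).support := by
        rw [mem_support_iff, coeff_add, hdq, zero_add]; exact hd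
      exact hdn ▸ le_weightedTotalDegree w hmem
  refine MvPolynomial.ext _ _ fun d => ?_
  rw [coeff_topComponent, hdeg, coeff_add]
  split_ifs with h
  · have hdq : coeff d q = 0 := by
      by_contra h'
      exact absurd h (ne_of_lt (hq d (mem_support_iff.mpr h')))
    rw [hdq, zero_add]
  · symm
    by_contra h'
    exact h (hr h')

/-- **A two-term face of `ST_2`**: the initial form of `ST_2` in direction `faceWeight` consists
of the two paths `x_{01} x_{1r} + x_{0r} x_{10}` (both use exactly one weighted edge; the star
uses none; both weighted edges together would be the 2-cycle). [folklore] -/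
theorem topComponent_stPoly_two :
    topComponent faceWeight (stPoly ℝ≥0 2) =
      X (0, some 1) * X (1, none) + X (0, none) * X (1, some 0) := by
  classical
  rw [stPoly_two, add_assoc]
  have hw1 : Finsupp.weight faceWeight
      (Finsupp.single ((0 : Fin 2), some (1 : Fin 2)) 1 + Finsupp.single ((1 : Fin 2), (none : Option (Fin 2))) 1) = 1 := by
    rw [map_add, Finsupp.weight_single, Finsupp.weight_single]; decide
  have hw2 : Finsupp.weight faceWeight
      (Finsupp.single ((0 : Fin 2), (none : Option (Fin 2))) 1 + Finsupp.single ((1 : Fin 2), some (0 : Fin 2)) 1) = 1 := by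
    rw [map_add, Finsupp.weight_single, Finsupp.weight_single]; decide
  have hw0 : Finsupp.weight faceWeight
      (Finsupp.single ((0 : Fin 2), (none : Option (Fin 2))) 1 + Finsupp.single ((1 : Fin 2), (none : Option (Fin 2))) 1) = 0 := by
    rw [map_add, Finsupp.weight_single, Finsupp.weight_single]; decide
  refine topComponent_add_eq_right faceWeight (n := 1) ?_ ?_ ?_
  · refine IsWeightedHomogeneous.add ?_ ?_
    · simp only [X, monomial_mul, mul_one]
      exact isWeightedHomogeneous_monomial _ _ _ hw1
    · simp only [X, monomial_mul, mul_one]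
      exact isWeightedHomogeneous_monomial _ _ _ hw2
  · -- `r ≠ 0`: its coefficient at the exponent of `x_{01} x_{1r}` is `1`
    intro h
    have hc : coeff (Finsupp.single ((0 : Fin 2), some (1 : Fin 2)) 1 +
        Finsupp.single ((1 : Fin 2), (none : Option (Fin 2))) 1)
        (X (0, some 1) * X (1, none) + X (0, none) * X (1, some 0) :
          MvPolynomial (Fin 2 × Option (Fin 2)) ℝ≥0) = 1 := by
      simp only [X, monomial_mul, mul_one, coeff_add, coeff_monomial, if_true]
      rw [if_neg, add_zero]
      intro h'
      have := congrArg (fun f : (Fin 2 × Option (Fin 2)) →₀ ℕ => f ((0 : Fin 2), some (1 : Fin 2))) h'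
      simp at this
    rw [h, coeff_zero] at hc
    exact zero_ne_one hc
  · intro d hd
    simp only [X, monomial_mul, mul_one] at hd
    have hd' : d = Finsupp.single ((0 : Fin 2), (none : Option (Fin 2))) 1 +
        Finsupp.single ((1 : Fin 2), (none : Option (Fin 2))) 1 := by
      have := support_monomial_subset hd
      simpa using this
    rw [hd', hw0]; exact one_pos

/-- **Positive `ST`-projections are not closed under initial forms**: the face
`top_{faceWeight}(ST_2) = x_{01} x_{1r} + x_{0r} x_{10}` of `ST_2` is not a positive projection of
any `ST_N`.  (It is of course a SUM of two such projections.) [folklore] -/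
theorem face_of_stPoly_two_not_posProj :
    ¬ ∃ (N : ℕ) (e : Fin N × Option (Fin N) → MvPolynomial (Fin 2 × Option (Fin 2)) ℝ≥0),
      (∀ v, (∃ j, e v = X j) ∨ ∃ r, e v = C r) ∧
      aeval e (stPoly ℝ≥0 N) = topComponent faceWeight (stPoly ℝ≥0 2) := by
  rw [topComponent_stPoly_two]
  exact not_posProj_XaXb_add_XcXd (a := ((0 : Fin 2), some (1 : Fin 2)))
    (b := ((1 : Fin 2), (none : Option (Fin 2)))) (c := ((0 : Fin 2), (none : Option (Fin 2))))
    (d := ((1 : Fin 2), some (0 : Fin 2))) (by simp) (by simp) (by simp) (by simp) (by simp)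

end Two

end

end Summit.ValiantsHypothesis.ValiantsHypothesis.Theorems.ZeroOneTransfer.Negative
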